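import Mathlib
import HarnessLib
import HarnessLib.Audit
import Summits.FinalStateConjecture.Statement
import Literature.Geometry.Lorentzian.FutureConeDensity
import Literature.Geometry.Lorentzian.ScaleCriticalConcentration
import HarnessLib.Audit.Status.Attr

/-!
Route: RaychaudhuriBlowdown

DORMANT since 2026-08-23T09:33:22Z (reconciler: no traction for 6 d (last activity statement-grounded at 2026-08-17T07:58:20Z); parked, not closed — `ledger route dormant route-FinalStateConjecture-RaychaudhuriBlowdown --off` to reactiv) — unstaffed, not closed; items shared with open routes are served there. `ledger route dormant <id> --off` reactivates.

# Route RaychaudhuriBlowdown — Bishop–Gromov blow-down at i⁺: flat cone off N rays, then Kerr near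
zones

It suffices to show X = C1 ∧ C2 ∧ C3 (re-typed 2026-08-16 against the T2 Statement p126844: TAME
genericity on one fixed end,
honest near-zone radii, future-oriented chart time, complete rays stay in closure O), the far-field
/ near-zone cut dictated by the
card raychaudhuri-bishop-gromov-blowdown ("the tangent cone at i⁺ is Minkowski with finitely many
inertial rays" = a late flat chart
on the half-space minus N sublinear tubes) plus the Statement's intrinsic lower bound on the settled
region. C1 (GenericCensorshipFlatCone,
the one GENERIC statement, since genericity is not closed under ∧; TAME-Christodoulou-generic,
`IsTameChristodoulouGeneric … 1`): for
generic admissible data an MGHD exists and every MGHD has complete 𝓘⁺, a FLAT CONE AT i⁺ OFF N RAYS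
— a late chart Ψ₀ from {x⁰ > τ₀}
minus N sublinearly growing tubes around timelike straight lines into J⁺(Σ), smooth, an open
embedding on the late region, with
Ψ₀^*g − η → 0 in C² on the slabs {x⁰ = τ} — and a sub-extremal end (every exhaustive,
future-oriented C² Kerr decomposition of its
d.o.c. has |aᵢ| < Mᵢ). C2 (NearZoneCompletion, pointwise): for EVERY admissible datum, an MGHD with
complete 𝓘⁺ and such a flat cone
admits the exhaustive (honest growing radii Rᵢ → ∞), future-oriented N′-Kerr decomposition of O =
J⁺(Σ) ∩ I⁻(charts) (|aᵢ| ≤ Mᵢ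
allowed). C3 (SettledExteriorHoldsRays, pointwise; verbatim the signature of TangentConeAtIPlus'
item stmt-FinalStateConjecture-17673,
so one proof serves both routes): for every such sub-extremal, exhaustive, future-oriented
decomposition of O = exteriorOf, every
future-complete normalised null ray from Σ stays in closure O. The card's monotone density
(Lorentzian Bishop–Gromov from
Raychaudhuri) and its almost-rigidity are the layer-2 engine for the flat-cone conjunct of C1; its
analytic core is filed as three
provable-now supports.
Lean: `GenericCensorshipFlatCone ∧ NearZoneCompletion ∧ SettledExteriorHoldsRays`

## Assembly
Pure logic, verified sorry-free (closes in glue.lean, lean check rc 0, 0 sorries; axioms propext,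
Classical.choice, Quot.sound):
TAME Christodoulou-genericity IsTameChristodoulouGeneric 𝓓 P 1 is monotone in P along implications
valid on 𝓓 (the exceptional set
shrinks; the same end and the same tame, immersed, injective admissible family work); apply it to P
= the property of
GenericCensorshipFlatCone and Q = the Statement's property: for an MGHD of an admissible datum with
(i),(ii),(iii), NearZoneCompletion
turns (i)+(ii) into O, d with O = exteriorOf d.charted, HasExhaustiveCharts d and IsFutureOriented
d, (iii) applied to that very d
gives sub-extremality, and SettledExteriorHoldsRays applied to (𝒟, O, d) gives RaysStayInClosure 𝒟
O.

Rationale: WHY THIS LINE. Raychaudhuri's equation along the timelike geodesic congruence from a late point p of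
a vacuum development gives θ' ≤ −θ²/3,
hence the Lorentzian Bishop–Gromov monotonicity of cone-volume densities Θ_p(U;τ)
(EhrlichJungKim1998; TreudeGrant2012 Lemma 3.3,
Thm 3.4, Thm 4.6; synthetic form CavallettiMondino2020) — a scale-invariant monotone quantity
needing no smallness, gauge or
symmetry, rigid exactly at flat cones in 3+1. Pointed at i⁺ instead of at singularities it imports
the Cheeger–Colding /
Cheeger–Tian structure theory of cones at infinity of Ricci-flat manifolds (CheegerColding1996,
CheegerTian1994,
ColdingMinicozzi2013) under an explicit dictionary: Bishop–Gromov ratio ↦ Θ_p, "the cone at infinity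
is flat with finitely
many orbifold rays, the end is ALE" ↦ "the cone at i⁺ is Minkowski off N inertial rays" = the
flat-cone conjunct of C1, with
the shear term of Raychaudhuri as an interior dissipation budget. The route records that cut as two
typed cruxes whose
conjunction provably decides the Statement (closes, sorry-free), isolates the near-zone Kerr engine
every FSC line needs as
C2, and files the comparison-geometry engine (almost-rigidity, shadow finiteness ⇒ flat chart) as
the foreseen split of C1;
no prior route exists on this summit and the negatives index is empty.

RANKED CRUXES. #2 GenericCensorshipFlatCone (crux; RESTATED 2026-08-16 for the re-typed Statement,
same decl name) — For every connected Hausdorff second-countable 3-manifold X,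
TAME-Christodoulou-generically in admissibleVacuumData X (IsTameChristodoulouGeneric … 1: the
witness family through an exceptional datum lives on ONE fixed asymptotically flat end with
Dafermos–Rodnianski rates and continuous mass, is weighted-C²₋₁×C¹₋₂-continuous and immersed at 0):
an MGHD exists, and every MGHD has (i) complete 𝓘⁺, (ii) a flat cone at i⁺ off finitely many rays —
N, Poincaré motions (Λᵢ,cᵢ), τ₀, sublinear radii ρᵢ (ρᵢ(t)/t → 0), an open U₀ ⊇ {x⁰ > τ₀, ρᵢ(x⁰) <
|spatial(Λᵢ⁻¹(x − cᵢ))| ∀ i} and a late chart Ψ₀ : U₀ → M into J⁺(Σ) (IsLateChart for the Minkowski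
background on U₀) with C² deviation of Ψ₀^*g from η on the slabs {x⁰ = τ} tending to 0 (orientation
is no clause: 'into J⁺(Σ) = D⁺(Σ)' forces it future, receding coordinate lines being g-timelike of
unbounded length while the time separation from Σ is finite) — and (iii) a sub-extremal end: every
C² final-state decomposition d of O = exteriorOf d.charted with exhaustive charts
(HasExhaustiveCharts, honest radii) AND future-oriented chart time (IsFutureOriented) has |aᵢ| < Mᵢ
for all i. (Card K2 + clause (i) + third law, bundled under ONE generic quantifier.) [difficulty:
open-problem] (why it might fail: Three generic-only claims at once, now in TAME codimension: weak
cosmic censorship (open); N < ∞ with no mass gap (nothing forbids generic formation of infinitely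
many ever-smaller receding holes); and the third law (KehleUnger2025: extremal horizons do form,
believed only in positive codimension, KehleUnger2024).) [DafermosLuk2017, Christodoulou1999,
KehleUnger2025, KehleUnger2024, CheegerTian1994, arXiv:2601.01517]
#3 NearZoneCompletion (crux; RESTATED 2026-08-16: conclusion carries IsFutureOriented d,
HasExhaustiveCharts has honest radii; same decl name) — For EVERY admissible datum D and every MGHD
of D with complete 𝓘⁺: a flat cone at i⁺ off N rays (the same far-field structure as in
GenericCensorshipFlatCone (ii)) upgrades to the full picture — there are O and a C²
FinalStateDecomposition d of O (N′ holes, 0 < Mᵢ, |aᵢ| ≤ Mᵢ, boosted Kerr near-zone charts with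
truncated C² convergence, separation, sublinear excision, flat chart, covering) with O = exteriorOf
d.charted, HasExhaustiveCharts d (growing honest radii Rᵢ(τ) ≥ max(r₊(Mᵢ,aᵢ),0)+1, Rᵢ → ∞; chart
time vs causal order; hole charts down to 𝓗⁺) and IsFutureOriented d (orthochronous Λᵢ,
push-forwards of Λᵢ V_{Mᵢ,aᵢ} and of ∂₀ eventually future-directed). (The imported near-zone engine;
the card's "orbifold points ↦ near zones"; sub-extremality is NOT claimed here — it comes
generically from #2 (iii).) [difficulty: open-problem] (why it might fail: Needs Kerr near-zone
stability for all |a| < M and several holes (printed: |a| ≪ M, one hole) plus rigidity without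
analyticity, on GROWING near zones; pointwise, so at exceptional extremal ends (KehleUnger2025)
Aretakis hair may defeat C² exhaustion; a far-field certificate says nothing inside its tubes.)
[KlainermanSzeftel2023, GiorgiKlainermanSzeftel2022, AlexakisIonescuKlainerman2009,
DafermosHolzegelRodnianskiTaylor2021, AngelopoulosKehleUnger2024, arXiv:2104.08222]
#4 BlowdownFlatChart (crux, rank 4; REPAIRED and TYPED 2026-08-16 as item
stmt-FinalStateConjecture-14581 after the crux-attack on stmt-9992 — F1: metric-ball shadow
finiteness is unsatisfiable once a hole can be entered, F2: one base curve cannot count occluded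
holes; the refuter's repairs R1 (visual cones ∪ vertex balls), R2 (open family of receding base
curves), F3 (asymptotic, locally uniform deficit), F4 (wave-zone input as a separate conjunct)
adopted, plus the scale-invariant curvature-decay input that #5's attack demands before any C²
clause) — for every admissible datum and MGHD 𝒟: complete 𝓘⁺ ∧ TAME SHADOWS ∧ FLAT WAVE ZONE ⇒
conjunct (ii) of #2 for 𝒟 verbatim (= the hypothesis of #3, so the foreseen split glues by
application; checked in the seat's Sketch.lean). TAME SHADOWS: there are N, an event p and a
hyperbolic ball B_p(w₀,η) ⊂ H⁺_p such that every geodesic γ_w = exp_p(s·w), w in the ball, is future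
complete (an open family of inertial vantage curves; co-moving/captured ones are excluded by the
ball) and carries N PARALLEL vertex fields P_i ∈ H⁺ and parallel unit axes Q_i ⊥ P_i with: ∀ ε, ρ >
0, for all late s, every direction w′ within rapidity ρ of γ̇_w(s) and outside the visual cones
C(P_i,Q_i,ε) ∪ vertex balls B(P_i,ε) has limsup_{r→0⁺} Θ_{γ_w(s)}(B_r(w′);τ₀) ≥ 1−ε for every τ₀ > 0
(Θ = Spacetime.futureConeDensity; hence the zero-density set lies in the ε-cones ∪ ε-balls
eventually — shadow finiteness with apertures → 0 is implied) and a scale-invariantly small tidal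
field along its ray, t²|Riem|_{γ̇′}(γ′(t)) ≤ ε (curvNormSqAdapted). FLAT WAVE ZONE: a late chart on
U_w ⊇ {x⁰ > τ_w, |x̲| > (1−δ)x⁰}, IsLateChart into J⁺(Σ), C² deviation from η → 0 on the full
unbounded slabs (which makes it asymptotically inertial, hence gluable). #4 consumes #5 only in its
C⁰/measured/some-cone form; C² comes from the curvature clause, the wave zone from the separate
conjunct; Schwarzschild calibration (the attack) favours it: bad set = Einstein cone ψ_E ≈
√(2M(1+v²)/D)/v ∪ capture/bound ball of rapidity ≈ √(2M/D), both → 0, deficit off them O((R_E/b)⁴) →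
0. (why it might fail: almost-rigidity C′ is unproved and C⁰-only; the density defect is 2nd order
in the shear while the cone-normal distortion is 1st order, so the cross-scale drift of the
re-identification φ must be killed by the parallel vertices; C² from sup t²|Riem| → 0 needs a
derivative-gaining gauge; interior/wave gluing needs both charts asymptotically inertial.)
[TreudeGrant2012, EhrlichSanchez2000, CheegerTian1994, Hattori2017, KlainermanNicolo2003,
KlainermanRodnianskiSzeftel2015, arXiv:1204.1767, arXiv:2009.08968, arXiv:2605.03172]
#5 LorentzianAlmostRigidity (crux, rank 5; REPAIRED 2026-08-16 as C′ after the paper refutation of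
the over-U / identity form by the Kasner comoving pencil, the near-flat Kasner pencil and the
Kruskal radial escape pencil — item evidence EVIDENCE.md, kasner_pencil.py, schw_pencil.py) —
non-collapsed, measured, some-cone, C⁰-only almost-rigidity of the Lorentzian Bishop–Gromov
inequality for pencils: ∀ v₀, ρ₀, η > 0 ∃ ε > 0 such that in every globally hyperbolic vacuum 3+1
spacetime, for every event p, unit future timelike u, scale τ > 0 and U = the hyperbolic ball
B_{ρ₀}(u) ⊂ H⁺_p with timelike cut > 4τ on the closed ball, Θ_p(U;4τ) ≥ v₀ and Θ_p(U;τ) ≤ Θ_p(U;4τ)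
+ ε, there are U_bad ⊆ U with |U_bad| ≤ η|U| and a C¹ immersion of directions φ (defined near
U∖U_bad, H⁺_p → H⁺_p) such that for v ∈ U∖U_bad, t ∈ [τ,2τ] the pulled-back metric exp_p^*g at tv is
η-close to the flat cone metric G_φ = Ψ^*η_p, Ψ(w) = |w|_g φ(w/|w|_g) (= −dt² + t²φ^*h_{ℍ³}: the
flat cone over φ(U∖U_bad)), RELATIVE to the Wick rotation of G_φ along φ(v) (a (1 ± η)
multiplicative comparison; rev 2 after refuter smell SMELL-14575 killed the rev-1 bound against the
un-stretched norm g_p + 2(v♭)² with the near-flat Kasner pencil); typed over FutureConeDensity.lean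
(Spacetime.futureConeDensity, timelikeCut, hyperboloidBall, hyperbolicMeasure) and
ExponentialMap.lean (expMap, mfderiv). Rigid case: equality ⇒ σ ≡ 0, θ = 3/s ⇒ g = −ds² + s²q ⇒ (Ric
= 0, dim 3) q hyperbolic ⇒ flat. No C^k clause (reverse-Burnett families), no 'dφ ≈ isometry'
(Kruskal: (J_r/t, J_⊥/t) → (1.372, 0.843)). (why it might fail: no Lorentzian Cheeger–Colding — no
C⁰ precompactness in Lorentzian signature and the TCD almost-splitting analogue is false
(arXiv:2605.03172); the density defect is second order in the shear while the cone-normal distortion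
is first order (ε buys only √ε per scale); the 3D step 'almost-umbilic vacuum slices ⇒ slice metric
C⁰-near φ^*h off a small-measure set' has no pointwise curvature control.) [CheegerColding1996,
Colding1997, TreudeGrant2012, EhrlichSanchez2000, EhrlichJungKim1998, CavallettiMondino2020,
arXiv:2605.03172, arXiv:2009.08968, HuneauLuk2024survey]
#6 SettledExteriorHoldsRays (crux, rank 6; ADDED 2026-08-16 for clause (C) of the re-typed Statement
— verbatim the signature of TangentConeAtIPlus' item stmt-FinalStateConjecture-17673, so one proof
serves both routes) — for EVERY admissible datum, every MGHD 𝒟 with complete 𝓘⁺ and EVERY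
sub-extremal C² FinalStateDecomposition fd of O = exteriorOf fd.charted with HasExhaustiveCharts fd
and IsFutureOriented fd: RaysStayInClosure 𝒟 O — every future-complete normalised null ray from Σ
stays in closure O. Content: a ray leaving closure(I⁻(charted)) has entered B = J⁺(ιΣ) ∖ closure O,
a future set, so every null ray from Σ entering B must be affinely incomplete in the MGHD (exact
sub-extremal Kerr: r₋ at finite affine parameter; near i⁺: Dafermos–Luk's C⁰-stable Cauchy horizon
at finite affine distance), while complete rays along 𝓗⁺ or out to 𝓘⁺ are limits of charted points.
Consumes exactly the outputs of #3 and #2 (iii). [difficulty: XL] (why it might fail: ∀-datum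
INTERIOR claim — incompleteness of every null ray from Σ entering the black-hole region is known
only for exact Kerr and near i⁺ (Dafermos–Luk); a complete infalling ray behind a smooth non-generic
Cauchy horizon, or a legal fd whose O undercuts the d.o.c., breaks it.) [arXiv:1710.01722,
DafermosLuk2017, Penrose1965, ONeill1983, HawkingEllis1973, arXiv:0811.0354]
#9 RaychaudhuriRiccatiBound (support) — Riccati comparison behind Raychaudhuri/Bishop–Gromov (card
P1, analytic core): any θ differentiable on (0,T) with θ' ≤ −θ²/3 satisfies θ(t) ≤ 3/t there (no
initial condition needed: a larger value would blow up backwards before t = 0). [difficulty: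
provable-now] [TreudeGrant2012, HawkingEllis1973]
#9 BishopGromovRatioAntitone (support) — Bishop–Gromov integration step (card P1): if A > 0 is
continuous on [0,T), differentiable on (0,T) with A' ≤ (3/t)A (area of distance spheres of a vacuum
timelike cone sector), then τ ↦ (∫₀^τ A)/τ⁴ is antitone on (0,T) (Gromov's ratio lemma; the cone
density Θ_p(U;·) is this ratio up to the constant |U|/4). [difficulty: provable-now]
[TreudeGrant2012, EhrlichJungKim1998, CheegerColding1996]
#9 ShearBudget (support) — Per-ray bulk dissipation budget (card P2): along a ray where θ' = −θ²/3 −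
s with s ≥ 0 continuous (s = |σ|² in vacuum) on [τ₀,T] and θ(T) ≥ 0 (no refocusing yet), ∫_{τ₀}^T s
≤ θ(τ₀) (≤ 3/τ₀ by RaychaudhuriRiccatiBound). [difficulty: provable-now] [TreudeGrant2012,
HawkingEllis1973]

TWO-LAYER PLAN. Foreseen glued splits (nothing filed as a split now; k ≤ 3, depth 1):
GenericCensorshipFlatCone ⇐ GenericCensorshipTameShadow → BlowdownFlatChart →
GenericCensorshipFlatCone, where
GenericCensorshipTameShadow = generic (MGHD ∧ complete 𝓘⁺ ∧ TAME SHADOWS ∧ FLAT WAVE ZONE — exactly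
the hypotheses of #4 — ∧ sub-extremal end) and
BlowdownFlatChart = [complete 𝓘⁺ ∧ tame shadows ∧ flat wave zone ⇒ flat cone off N rays] — the
card's K2(b), powered by the monotone
density (supports) + LorentzianAlmostRigidity (card K1, C⁰) + its scale-invariant curvature-decay
clause for C²; both are typed since 2026-08-16
in their repaired forms (RANKED CRUXES #4 = item 14581, #5) now that lorentzDist / futureConeDensity
/ timelikeShadow have landed, and the split
reuses both by signature (its glue is application). NearZoneCompletion ⇐ TubeSettlesToKerr (per
tube: event horizon +
C² convergence to boosted Kerr on growing near zones, the imported stability/rigidity engine) →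
ExhaustionGlue
(horizon-normalised future-oriented charts, honest growing radii, chart time vs causal order, O =
exteriorOf) → NearZoneCompletion. LorentzianAlmostRigidity (C′) ⇐
per-ray Chebyshev [small drop ⇒ f_v = det J_v/s³ almost constant on [δτ,4τ] off a small-measure
U_bad ⇒ shear L²-small, exp_p^*g ≈ −ds² + s²q along good rays]
→ 3D almost-rigidity [q_s almost s-independent + Ric(−ds²+s²q_s) = 0 ⇒ q C⁰-near an immersed
hyperbolic metric φ^*h off small measure]; no ε-regularity / C^k step any more.

KILL CRITERIA. Close `refuted:NearZoneCompletion` if an admissible datum is exhibited whose MGHD has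
complete 𝓘⁺ and a flat cone off N rays
but a tube that never settles to Kerr (eternal breather / non-Kerr stationary end) — that refutes
FSC's settling clause as
typed, not just this line. `refuted:GenericCensorshipFlatCone` by generic N = ∞ or generic extremal
formation likewise
kills the Statement; by failure of WCC alone → every FSC route dies. The LINE (not the skeleton)
dies if BlowdownFlatChart
is refuted — e.g. the Schwarzschild calibration shows every receding maximiser from late base points
meets a cut point at
finite rescaled time, so Θ_p sees nothing — or if Lorentzian "almost volume cone ⇒ almost metric
cone" is shown false for
smooth vacuum developments IN ITS REPAIRED measured / some-cone / C⁰ form C′ (the over-U identity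
form IS false — Kasner and Kruskal pencils, 2026-08-16 — and was restated, not mourned): then close
`refuted:BlowdownFlatChart`, leaving C1/C2 as shared skeleton for the
tangent-cone / endgame cards. If NearZoneCompletion is refuted ONLY at exceptional extremal ends
(Aretakis growth spoiling C² exhaustion), repair by `--restate`: add the hypothesis that every
exhaustive C⁰ decomposition of the d.o.c. is sub-extremal (C1 (iii) in C⁰ form, true vacuously at
extremal ends) and re-glue through FinalStateDecomposition.ofLE. A proof elsewhere of generic WCC +
far-field flatness moots C1's first two conjuncts. `refuted:SettledExteriorHoldsRays` (an MGHD with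
a future-complete null ray from Σ leaving closure O for a legal exhaustive future-oriented
decomposition) kills clause (C) of the re-typed Statement pointwise for every route sharing the
item; if the witness is a NON-GENERIC interior (smooth complete Cauchy horizon), repair by moving
the ray clause under the generic quantifier of #2 (conjunct (iv), `--restate` + re-glue).

NOT DECOMPOSED YET. (Re-type 2026-08-16: should a refuter dispute that 'IsLateChart into J⁺(Σ)'
forces the orientation of the far-field certificate (ii), the repair is one `IsFutureDirected (dΨ₀
∂₀)` conjunct added simultaneously to (ii) of #2, the hypothesis of #3 and the conclusion of #4.)
The definitions the engine needs have LANDED (LorentzianDistance.lean, FutureConeDensity.lean,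
TimelikeShadow.lean; nothing posited
inside items); the C⁰→C² vacuum upgrade inside BlowdownFlatChart, now explicitly CONDITIONAL on a
curvature bound sup t²|Riem| ≤ Λ (bounded-L²-curvature local theory; unconditional versions die on
reverse-Burnett families, arXiv:2009.08968);
the supplements of C′ (|det dφ − 1| ≤ η under Θ(4τ) ≥ 1 − ε; general open U by Vitali covering of
pencils); (the former 'p-dependence of Θ_p / choice of base points p_n → i⁺' is settled by the typed
#4: vantage family exp_p(s·w), parallel vertices); cut-locus bookkeeping near the holes
(lensing-closed direction sets); the
Fischer–Moncrief renormalised-volume budget at 𝓘⁺ (card K3) and the blow-UP no-go / homothety-defect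
functional (card K4),
which are hand-offs to the quiet-window and wcc cards, not items here; every constant of the
near-zone engine (C2 is one
node until a single-tube theorem closes).

CHEAPEST FALSIFIER. Schwarzschild calibration (card P3/(b)): for a static base point at areal
distance D ≫ M and U = the outward unit hemisphere
of velocities with |v| ≤ v₀ < 1, compute Θ_p(U;τ) from the exact geodesic structure: it must
decrease to a positive limit
with defect O(M/D) (captured directions have impact parameter b ≤ b_c(v) ≈ 4M/v for slow and 3√3·M
for fast geodesics, a
disc of angular radius ≈ b_c/D → 0); if instead conjugate/cut points occur at finite rescaled time
for a.e. receding
direction, the density framework is blind and BlowdownFlatChart dies. Not run here (the hub is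
compute-free for planners in
this mode); it is a one-page calculation or a small kit job for the refuter.

NUMBERS. Raychaudhuri in 3+1 vacuum along unit timelike geodesics: θ' = −θ²/3 − |σ|² (vorticity 0
for the cone congruence), so
θ ≤ 3/t and Vol_η of the Minkowski cone sector is |U|_{ℍ³} τ⁴/4 (TreudeGrant2012 Lemma 3.3, Thm 3.4,
Thm 4.6 with κ = 0,
n = 3). Regularity asked by the Statement: C² on slabs (k = 2), no rate — so Price-law tails t⁻³ and
logarithmic drifts
(M/v²) log t of the holes' world-lines are absorbed by the free charts and the sublinear tubes ρᵢ =
o(t). Printed near-zone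
engine: |a|/M ≪ 1, one hole (KlainermanSzeftel2023, GiorgiKlainermanSzeftel2022). Capture
cross-section calibrating
"shadow radii → 0": b_c → 3√3 M (v → 1), b_c ≈ 4M/v (v → 0). Refuter calibrations of the cone
density (jobs j011155 kasner_pencil.py, j011157 schw_pencil.py, 2026-08-16):
Kruskal radial escape pencil R = 3M, v = 0.9, τ = 10⁶M: drop Θ(τ)−Θ(4τ) = 1.4e-6, density defect
0.0246, (J_r/t, J_⊥/t) → (1.372, 0.843) (flat cone over φ(U) ≠ U);
Kasner u = 2 comoving pencil, τ = 1e10: drop 2.9e-3 at density 0.006 (drop ≈ density/3 per 4-adic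
scale — killed by the floor v₀ in C′);
near-flat Kasner u = 50: Θ(4τ) = 0.984, drop 1.07e-3, identity-identification distortion 1.28
(absorbed by φ in C′).
Items (rev 10, 2026-08-16): 9 typed = 5 cruxes (r2, r3 restated for the T2 Statement; r4; r5; r6
SettledExteriorHoldsRays shared with TangentConeAtIPlus) + 3 supports + 1 assembly ≤ 15; closes : C1
→ C2 → C3 → FinalStateConjecture (rc 0, 0 sorries).

DEFINITION REQUESTS. None open. All three posited notions LANDED by 2026-08-16 in
Literature/Geometry/Lorentzian — LorentzianMetric.lorentzDist (time separation),
TimeOrientation/Spacetime.futureConeDensity with timelikeCut / futureConeSector / hyperboloidBall /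
hyperbolicMeasure (the cone density Θ_p(U;τ), Minkowski value 1), TimeOrientation.timelikeShadow /
zeroDensityDirections — and #4/#5 are typed over them. Cite fact still wanted (not load-bearing for
closes): Lorentzian Bishop–Gromov for distance cones / SCMCB congruences under Ric(timelike) ≥ 0
with rigidity (EhrlichJungKim1998; TreudeGrant2012 Thm 4.6, 4.10) as a named fact over lorentzDist.

Novelty: Searches (2026-08-15, this seat): `lit search "Lorentzian Bishop-Gromov volume comparison timelike"
--source zbmath` (2: EhrlichJungKim1998, arXiv:2603.24195); `lit search "Lorentzian splitting
timelike curvature dimension" --source zbmath` (6: Woolgar–Wylie doi:10.1016/j.geomphys.2018.06.001,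
Beem–Ehrlich–Markvorsen 1985, arXiv:2605.03172 Mondino–Ryborz–Sämann C⁰-stability of TCD,
arXiv:2305.04389, arXiv:2506.02723); `lit search "tangent cone at infinity spacetime timelike
infinity blow-down vacuum" --source arxiv` (0); `lit search "Lorentzian synthetic timelike curvature
volume cone metric cone almost rigidity splitting" --source arxiv` (0); `lit search … Cheeger Tian
--source crossref` (5: CheegerTian1994, Hattori2017 non-uniqueness of tangent cones at infinity of
Ricci-flat manifolds, Semola 2026); `lit search … Colding Minicozzi --source crossref`
(ColdingMinicozzi2013); `lit galaxy search "Bishop-Gromov" --star pdf -n 40` (40: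
Riemannian/RCD/Ricci-flow uses; Graf arXiv:1507.08931 C^{1,1} Lorentzian volume comparison;
Brown–Freedman arXiv:2301.07812 "improved long-time Bishop–Gromov using shear" — a Riemannian shear
budget; Sormani math/0302244); `lit galaxy search "cone structure at infinity" --star pdf` (4, all
Riemannian); `lit galaxy search "volume comparison for Lorentzian" --star all` (1 book,
Duggal–Sahin); `lit frontier FinalStateConjecture --since 2023` (30 rows: no comparison-geometry
item; arXiv:2601.01517 multi-black-hole data, arXiv:2601.04152 visibility of  [refs: 10.1016/j.geomphys.2018.06.001, 2603.24195, 2605.03172, 2305.04389, 2506.02723, 1507.08931, 2301.07812, 2601.01517, 2601.04152, doi:10.1016/j.geomphys.2018.06.001, EhrlichJungKim1998, CheegerTian1994, Hattori2017, ColdingMinicozzi2013, TreudeGrant2012, CavallettiMondino2020, CheegerColding1996, Eschenburg1989]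

Barriers (technique_class: comparison-geometry, monotonicity-formula, blow-down): - technique_class: comparison-geometry, monotonicity-formula, blow-down
- Literature.Barriers.FinalStateConjecture.SlowlyRotatingKerrFrontier: it does not evade it; it
isolates it — NearZoneCompletion needs the near-zone engine for all |a| < M and several holes,
printed only for |a| ≪ M; the bet is that this node is shared by every FSC line and is attacked
there, while this line's own content (the flat cone) is frontier-free.
- Literature.Barriers.FinalStateConjecture.SbierskiTrappingObstruction: binds only the engine inside
NearZoneCompletion (derivative loss through trapping); the flat-cone conjunct and the density are
estimate-free, and the Statement asks C² convergence with no rate.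
- Literature.Barriers.FinalStateConjecture.PriceLawTail: harmless — no decay rate is claimed
anywhere (C² deviation → 0 only); tails are absorbed by the free charts.
- Literature.Barriers.FinalStateConjecture.AretakisInstability: excluded generically by the
sub-extremal-end conjunct of GenericCensorshipFlatCone; it DOES bear on the pointwise
NearZoneCompletion at exceptional extremal ends (|aᵢ| = Mᵢ is allowed there, but horizon hair may
spoil C² convergence of horizon-normalised charts) — declared in its why-line with the restate that
repairs it; the bet is that k = 2 of the metric sits below the order at which gravitational Aretakis
growth starts.
- Literature.Barriers.FinalStateConjecture.nakedSingularityInstability: consistent — censorship is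
claimed only Christodoulou-generically (the ins

History (route lifecycle, newest last):
- 2026-08-16T03:32:50Z · rev 8: restated LorentzianAlmostRigidity (stmt-FinalStateConjecture-9993) — repair (route-repair, refuted-misstated on paper by refuter-rattack-stmt-FinalStateConjecture-9993-0, EVIDENCE.md §5): LorentzianAlmostRigidity (stmt-FinalState (planner-rrefute-FinalStateConjecture-Raychaudh-1130626c-0)
- 2026-08-16T03:46:02Z · rev 8: restated LorentzianAlmostRigidity (stmt-FinalStateConjecture-14575) — repair rev 2 (same seat): LorentzianAlmostRigidity (now stmt-FinalStateConjecture-14575) restated once more after the refuter pre-check SMELL-14575 (refuter-rat (planner-rrefute-FinalStateConjecture-Raychaudh-1130626c-0)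
- 2026-08-16T03:58:48Z · rev 8: restated BlowdownFlatChart (stmt-FinalStateConjecture-9992) — route-repair (refuted-misstated, crux-attack 2026-08-16 on stmt-FinalStateConjecture-9992): BlowdownFlatChart TYPED and restated with the refuter's repairs — R1 (planner-rrefute-FinalStateConjecture-Raychaudh-7eb75c48-0)
- 2026-08-16T23:48:27Z · rev 10: restated GenericCensorshipFlatCone (stmt-FinalStateConjecture-9956), NearZoneCompletion (stmt-FinalStateConjecture-9957), Assembly (stmt-FinalStateConjecture-9961) — route-repair (glue.unproved after Statement re-type p126844/T2): GenericCensorshipFlatCone restated over IsTameChristodoulouGeneric with (iii) ran (planner-rbadge-FinalStateConjecture-Raychaudhu-cebb32eb-g2-0)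
- 2026-08-23T09:33:22Z · DORMANT — reconciler: no traction for 6 d (last activity statement-grounded at 2026-08-17T07:58:20Z); parked, not closed — `ledger route dormant route-FinalStateConjectur (operator:999:2089520)

sub-problem: FinalStateConjecture · status: dormant · opened planner-plancard-FinalStateConjecture-FinalSt-92a689e5-0 2026-08-15T14:57:38Z · rev 12 · ledger route-FinalStateConjecture-RaychaudhuriBlowdown
GENERATED by the gate from the ledger (D-0016/17). Provers cite these decls: `theorem foo : Summit.FinalStateConjecture.FinalStateConjecture.Theses.RaychaudhuriBlowdown.<Decl> := …` in Summits/FinalStateConjecture/FinalStateConjecture/Theorems/<Name>.lean.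
-/

namespace Summit.FinalStateConjecture.FinalStateConjecture.Theses.RaychaudhuriBlowdown

open scoped BigOperators Topology Manifold Classical MeasureTheory ProbabilityTheory Matrix InnerProductSpace ComplexConjugate ContinuousMap
open Filter Set Function TopologicalSpace MeasureTheory

attribute [summit_statement] _root_.FinalStateConjecture

-- earlier GenericCensorshipFlatCone (stmt-FinalStateConjecture-9956, replaced 2026-08-16T23:48:27Z -> stmt-FinalStateConjecture-18026): retired by None — ∀ (X : Type) [TopologicalSpace X] [ChartedSpace (EuclideanSpace ℝ (Fin 3)) X] [IsManifold (𝓡 3) ((⊤ : ℕ∞) : WithTop ℕ∞) X] [T2Space X] [SecondCountableTopology X] [ConnectedSpace X], Literature.Geometry.Lorentzian.InitialDataSet.IsChristodoulouGene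
/-- item stmt-FinalStateConjecture-18026 · crux · rank 2 · open · by planner
why it might fail: Three open GENERIC claims at once, now in TAME codimension 1 (witness family on one fixed end, immersed at 0): weak cosmic censorship; N < ∞ with no mass gap (generic cascades of ever-smaller receding holes not excluded); generic third law — false pointwise (KehleUnger2025), conjecturally codim 1.
sources: Christodoulou1999, DafermosLuk2017, KehleUnger2025, KehleUnger2024, ShenWan2026, CheegerTian1994
[crux] (RESTATED 2026-08-16 for the re-typed Statement p126844/T2: TAME genericity; (iii) ranges
over exhaustive AND future-oriented decompositions; same decl name.) For every connected Hausdorff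
second-countable 3-manifold X, TAME-Christodoulou-generically in admissibleVacuumData X
(IsTameChristodoulouGeneric … 1: through every exceptional admissible datum passes an injective
one-parameter admissible family, tame on ONE fixed asymptotically flat end — Dafermos–Rodnianski
rates with continuous mass, weighted C²₋₁×C¹₋₂-continuous at 0 — and immersed at 0, all of whose
other members are good): an MGHD exists, and every MGHD has (i) complete 𝓘⁺ (sojourn form), (ii) a
FLAT CONE AT i⁺ OFF FINITELY MANY RAYS — N, Poincaré motions (Λᵢ,cᵢ), τ₀, sublinear radii ρᵢ
(ρᵢ(t)/t → 0), an open U₀ ⊇ {x⁰ > τ₀, ρᵢ(x⁰) < |spatial(Λᵢ⁻¹(x − cᵢ))| ∀ i} and a late chart Ψ₀ : U₀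
→ M into J⁺(Σ) (IsLateChart for the Minkowski background on U₀; its time orientation is forced
future by 'into J⁺(Σ) = D⁺(Σ)': slowly receding coordinate lines are g-timelike of unbounded length
while the time separation from the Cauchy hypersurface is finite) with C² deviation of Ψ₀^*g from η
on the slabs {x⁰ = τ} tending to 0 — a -/
@[route_item "route-FinalStateConjecture-RaychaudhuriBlowdown", crux]
def GenericCensorshipFlatCone : Prop :=
  ∀ (X : Type) [TopologicalSpace X] [ChartedSpace (EuclideanSpace ℝ (Fin 3)) X] [IsManifold (𝓡 3) ((⊤ : ℕ∞) : WithTop ℕ∞) X] [T2Space X] [SecondCountableTopology X] [ConnectedSpace X], Literature.Geometry.Lorentzian.InitialDataSet.IsTameChristodoulouGeneric (Literature.Geometry.Lorentzian.admissibleVacuumData X) (fun D ↦ (∃ 𝒟 : Literature.Geometry.Lorentzian.VacuumCauchyDevelopment D, 𝒟.IsMaximal) ∧ ∀ 𝒟 : Literature.Geometry.Lorentzian.VacuumCauchyDevelopment D, 𝒟.IsMaximal → Summit.FinalStateConjecture.HasCompleteNullInfinity 𝒟.toCauchyDevelopment ∧ (∃ (N : ℕ) (motion : Fin N → Literature.Geometry.Lorentzian.lorentzGroup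 × EuclideanSpace ℝ (Fin 4)) (τ₀ : ℝ) (ρ : Fin N → ℝ → ℝ) (U₀ : TopologicalSpace.Opens (EuclideanSpace ℝ (Fin 4))) (Ψ₀ : U₀ → 𝒟.carrier), (∀ i, Filter.Tendsto (fun t ↦ ρ i t / t) Filter.atTop (nhds 0)) ∧ {x : EuclideanSpace ℝ (Fin 4) | τ₀ < x 0 ∧ ∀ i, ρ i (x 0) < Literature.Geometry.Lorentzian.E4.spatialNorm (Literature.Geometry.Lorentzian.poincareInv (motion i).1 (motion i).2 x)} ⊆ (U₀ : Set (EuclideanSpace ℝ (Fin 4))) ∧ 𝒟.toSpacetime.IsLateChart (Literature.Geometry.Lorentzian.Minkowski.backgroundOn U₀) (𝒟.metric.causalFuture 𝒟.timeOrientation (Set.range 𝒟.embed)) τ₀ Ψ₀ ∧ Filter.Tendsto (fun τ ↦ 𝒟.toSpacetime.deviationCk (Literature.Geometry.Lorentzian.Minkowski.backgroundOn U₀) Ψ₀ 2 τ) Filter.atTop (nhds 0)) ∧ ∀ (O : Set 𝒟.carrier) (d : Literature.Geometry.Lorentzian.FinalStateDecomposition 𝒟.toSpacetime O 2), O = Summit.FinalStateConjecture.exteriorOf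 𝒟.toCauchyDevelopment d.charted → Summit.FinalStateConjecture.HasExhaustiveCharts d → Summit.FinalStateConjecture.IsFutureOriented d → ∀ i, Literature.Geometry.Lorentzian.Kerr.IsSubextremal (d.mass i) (d.spin i)) 1

-- earlier NearZoneCompletion (stmt-FinalStateConjecture-9957, replaced 2026-08-16T23:48:27Z -> stmt-FinalStateConjecture-18027): retired by None — ∀ (X : Type) [TopologicalSpace X] [ChartedSpace (EuclideanSpace ℝ (Fin 3)) X] [IsManifold (𝓡 3) ((⊤ : ℕ∞) : WithTop ℕ∞) X] [T2Space X] [SecondCountableTopology X] [ConnectedSpace X], ∀ D ∈ Literature.Geometry.Lorentzian.admissibleVacuumData X, ∀ 𝒟 : Liter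
/-- item stmt-FinalStateConjecture-18027 · crux · rank 3 · open · by planner
why it might fail: Pointwise: needs nonlinear Kerr stability for all |a|<M and N′≥2 holes (proved: |a|≪M, one hole) plus rigidity without analyticity, on GROWING near zones (honest radii Rᵢ→∞) with future-oriented horizon-normalised charts; at exceptional extremal ends Aretakis growth may defeat C² exhaustion.
sources: KlainermanSzeftel2023, GiorgiKlainermanSzeftel2022, DafermosHolzegelRodnianskiTaylor2021, ShlapentokhrothmanCosta2023, AlexakisIonescuKlainerman2009, AngelopoulosKehleUnger2024
[crux] (RESTATED 2026-08-16 for the re-typed Statement: the conclusion carries IsFutureOriented d,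
and HasExhaustiveCharts now has honest radii Rᵢ(τ) ≥ max(r₊(Mᵢ,aᵢ),0)+1, Rᵢ → ∞; same decl name.)
For EVERY admissible datum D and every MGHD 𝒟 of D with complete 𝓘⁺: a flat cone at i⁺ off N rays
(verbatim conjunct (ii) of GenericCensorshipFlatCone = the conclusion of BlowdownFlatChart) upgrades
to the full picture — there are O and a C² FinalStateDecomposition d of O (N′ holes, 0 < Mᵢ, |aᵢ| ≤
Mᵢ allowed, boosted Kerr near-zone charts with truncated C² convergence, separation, sublinear
excision, flat chart, covering) with O = exteriorOf d.charted, HasExhaustiveCharts d (growing honest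
near zones, chart time agrees with causal order, hole charts normalised to 𝓗⁺) and IsFutureOriented
d (orthochronous Λᵢ; the push-forwards of the Kerr–Schild future timelike fields Λᵢ V_{Mᵢ,aᵢ} on
late truncated slabs and of ∂₀ on late flat slabs are future-directed causal). (The imported
near-zone engine; the card's 'orbifold points ↦ near zones'. Sub-extremality is NOT claimed here —
it comes generically from GenericCensorshipFlatCone (iii); the ray clause is
SettledExteriorHoldsRays.) [deps: none] [d -/
@[route_item "route-FinalStateConjecture-RaychaudhuriBlowdown", crux]
def NearZoneCompletion : Prop :=
  ∀ (X : Type) [TopologicalSpace X] [ChartedSpace (EuclideanSpace ℝ (Fin 3)) X] [IsManifold (𝓡 3) ((⊤ : ℕ∞) : WithTop ℕ∞) X] [T2Space X] [SecondCountableTopology X] [ConnectedSpace X], ∀ D ∈ Literature.Geometry.Lorentzian.admissibleVacuumData X, ∀ 𝒟 : Literature.Geometry.Lorentzian.VacuumCauchyDevelopment D, 𝒟.IsMaximal → Summit.FinalStateConjecture.HasCompleteNullInfinity 𝒟.toCauchyDevelopment → (∃ (N : ℕ) (motion : Fin N → Literature.Geometry.Lorentzian.lorentzGroup × EuclideanSpace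 ℝ (Fin 4)) (τ₀ : ℝ) (ρ : Fin N → ℝ → ℝ) (U₀ : TopologicalSpace.Opens (EuclideanSpace ℝ (Fin 4))) (Ψ₀ : U₀ → 𝒟.carrier), (∀ i, Filter.Tendsto (fun t ↦ ρ i t / t) Filter.atTop (nhds 0)) ∧ {x : EuclideanSpace ℝ (Fin 4) | τ₀ < x 0 ∧ ∀ i, ρ i (x 0) < Literature.Geometry.Lorentzian.E4.spatialNorm (Literature.Geometry.Lorentzian.poincareInv (motion i).1 (motion i).2 x)} ⊆ (U₀ : Set (EuclideanSpace ℝ (Fin 4))) ∧ 𝒟.toSpacetime.IsLateChart (Literature.Geometry.Lorentzian.Minkowski.backgroundOn U₀) (𝒟.metric.causalFuture 𝒟.timeOrientation (Set.range 𝒟.embed)) τ₀ Ψ₀ ∧ Filter.Tendsto (fun τ ↦ 𝒟.toSpacetime.deviationCk (Literature.Geometry.Lorentzian.Minkowski.backgroundOn U₀) Ψ₀ 2 τ) Filter.atTop (nhds 0)) → ∃ (O : Set 𝒟.carrier) (d : Literature.Geometry.Lorentzian.FinalStateDecomposition 𝒟.toSpacetime O 2), O = Summit.FinalStateConjecture.exteriorOf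 𝒟.toCauchyDevelopment d.charted ∧ Summit.FinalStateConjecture.HasExhaustiveCharts d ∧ Summit.FinalStateConjecture.IsFutureOriented d

-- earlier BlowdownFlatChart (stmt-FinalStateConjecture-9992, replaced 2026-08-16T03:58:48Z -> stmt-FinalStateConjecture-14581): retired by None — [crux] BLOW-DOWN FLAT CHART (card raychaudhuri-bishop-gromov-blowdown, K2(b); the foreseen child of GenericCensorshipFlatCone (ii)). For an MGHD of an admissible datum with complete 𝓘⁺, take base points p_n → i⁺ along one future-complete timelike curve in 
/-- item stmt-FinalStateConjecture-14581 · crux · rank 4 · open · by planner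
why it might fail: Almost-rigidity C′ unproved (no Lorentzian Cheeger–Colding; arXiv:2605.03172) and only C⁰/measured/some-cone: defect 2nd order in shear, distortion 1st, so cross-scale drift of φ must be killed by the parallel vertices; C² from sup t²|Riem|→0 needs a derivative-gaining gauge; interior/wave gluing.
sources: TreudeGrant2012, EhrlichSanchez2000, EhrlichJungKim1998, CheegerTian1994, ColdingMinicozzi2013, Hattori2017
[crux] BLOW-DOWN FLAT CHART — repaired after the crux-attack of 2026-08-16 (refuted-misstated: F1
metric-ball shadow finiteness is unsatisfiable once a hole is enterable, F2 one base curve cannot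
count occluded holes; repairs R1 R2 F3 F4 adopted; card raychaudhuri-bishop-gromov-blowdown K2(b);
foreseen child of GenericCensorshipFlatCone (ii)). For every admissible datum and every MGHD 𝒟:
complete 𝓘⁺ ∧ TAME SHADOWS ∧ FLAT WAVE ZONE ⇒ FlatConeAtIPlus 𝒟, i.e. conjunct (ii) of
GenericCensorshipFlatCone for this 𝒟 verbatim (= the far-field hypothesis of NearZoneCompletion, so
the split glues by application). TAME SHADOWS (R1+R2+F3 + scale-invariant curvature decay): there
are N, an event p and a hyperbolic ball B_p(w₀,η) ⊂ ℍ³_p of future unit timelike directions such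
that for EVERY w in it the timelike geodesic γ_w(s) = exp_p(s·w) is future complete (an open family
of receding inertial base curves; co-moving/captured ones are excluded by the choice of the ball)
and carries N PARALLEL future-unit-timelike fields P_i (vertices = limiting hole 4-velocities) and
parallel unit spacelike fields Q_i ⊥ P_i (axes = limiting sky directions of the holes) with: for all
ε>0, ρ>0 and all late s, ever -/
@[route_item "route-FinalStateConjecture-RaychaudhuriBlowdown"]
def BlowdownFlatChart : Prop :=
  open Literature.Geometry.Lorentzian Literature.Geometry.Riemannian in open scoped ContDiff ENNReal in let Tame := fun (𝓢 : Spacetime.{0} 4) (N : ℕ) (p : 𝓢.carrier) (w₀ : E4) (η : ℝ) => haveI : Fact ((1 : ℕ∞ω) ≤ ((⊤ : ℕ∞) : ℕ∞ω)) := ⟨Spacetime.one_le_infty⟩; haveI := 𝓢.metric.hasLeviCivita; let g := 𝓢.metric; let tor := 𝓢.timeOrientation; let cov := g.leviCivita; let H := fun (q : 𝓢.carrier) => tor.futureUnitTimelike q; let ball := fun (q : 𝓢.carrier) (v : E4) (r : ℝ) => tor.hyperboloidBall (x := q) v r; let vcone := fun (q : 𝓢.carrier) (v e : E4) (r : ℝ)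 => {w : E4 | w ∈ H q ∧ Real.cos r * Real.sqrt ((g.val q v w) ^ 2 - 1) < g.val q w e}; w₀ ∈ H p ∧ 0 < η ∧ ∀ w ∈ ball p w₀ η, let γ := maximalGeodesic cov p w; Set.Ici (0 : ℝ) ⊆ maximalGeodesicDomain cov p w ∧ ∃ P Q : Fin N → ℝ → E4, (∀ i, ∀ s : ℝ, 0 < s → P i s ∈ H (γ s) ∧ g.val (γ s) (Q i s) (Q i s) = 1 ∧ g.val (γ s) (P i s) (Q i s) = 0 ∧ MDifferentiableAt 𝓘(ℝ, ℝ) (𝓡 4).tangent (fun t ↦ (Bundle.TotalSpace.mk' E4 (γ t) (P i t) : TangentBundle (𝓡 4) 𝓢.carrier)) s ∧ MDifferentiableAt 𝓘(ℝ, ℝ) (𝓡 4).tangent (fun t ↦ (Bundle.TotalSpace.mk' E4 (γ t) (Q i t) : TangentBundle (𝓡 4) 𝓢.carrier)) s ∧ covariantDerivAlong cov γ (fun t ↦ P i t) s = 0 ∧ covariantDerivAlong cov γ (fun t ↦ Q i t) s = 0) ∧ ∀ ε : ℝ, 0 < ε → ∀ ρ : ℝ, 0 < ρ → ∀ᶠ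 s in atTop, ∀ w' ∈ ball (γ s) (velocity (𝓡 4) γ s) ρ, (∀ i, w' ∉ vcone (γ s) (P i s) (Q i s) ε ∧ w' ∉ ball (γ s) (P i s) ε) → (∀ τ₀ : ℝ, 0 < τ₀ → ENNReal.ofReal (1 - ε) ≤ Filter.limsup (fun r : ℝ ↦ 𝓢.futureConeDensity (γ s) (ball (γ s) w' r) τ₀) (𝓝[>] (0 : ℝ))) ∧ (∀ t ∈ maximalGeodesicDomain cov (γ s) w', 0 < t → t ^ 2 * Real.sqrt (g.curvNormSqAdapted (maximalGeodesic cov (γ s) w' t) (velocity (𝓡 4) (maximalGeodesic cov (γ s) w') t)) ≤ ε); let Wave := fun (𝓢 : Spacetime.{0} 4) (S : Set 𝓢.carrier) => ∃ (δ τw : ℝ) (Uw : Opens E4) (Φ : Uw → 𝓢.carrier), 0 < δ ∧ {x : E4 | τw < x 0 ∧ (1 - δ) * x 0 < E4.spatialNorm x} ⊆ (Uw : Set E4) ∧ 𝓢.IsLateChart (Minkowski.backgroundOn Uw) (𝓢.metric.causalFuture 𝓢.timeOrientation S) τw Φ ∧ Tendsto (fun τ ↦ 𝓢.deviationCk (Minkowski.backgroundOn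 Uw) Φ 2 τ) atTop (𝓝 0); ∀ (X : Type) [TopologicalSpace X] [ChartedSpace E3 X] [IsManifold (𝓡 3) ∞ X] [T2Space X] [SecondCountableTopology X] [ConnectedSpace X], ∀ D ∈ admissibleVacuumData X, ∀ 𝒟 : VacuumCauchyDevelopment D, 𝒟.IsMaximal → Summit.FinalStateConjecture.HasCompleteNullInfinity 𝒟.toCauchyDevelopment → (∃ (N : ℕ) (p : 𝒟.carrier) (w₀ : E4) (η : ℝ), Tame 𝒟.toSpacetime N p w₀ η) → Wave 𝒟.toSpacetime (range 𝒟.embed) → ∃ (N : ℕ) (motion : Fin N → lorentzGroup × E4) (τ₀ : ℝ) (ρ : Fin N → ℝ → ℝ) (U₀ : Opens E4) (Ψ₀ : U₀ → 𝒟.carrier), (∀ i, Tendsto (fun t ↦ ρ i t / t) atTop (𝓝 0)) ∧ {x : E4 | τ₀ < x 0 ∧ ∀ i, ρ i (x 0) < E4.spatialNorm (poincareInv (motion i).1 (motion i).2 x)} ⊆ (U₀ : Set E4) ∧ 𝒟.toSpacetime.IsLateChart (Minkowski.backgroundOn U₀) (𝒟.metric.causalFuture 𝒟.timeOrientation (range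 𝒟.embed)) τ₀ Ψ₀ ∧ Tendsto (fun τ ↦ 𝒟.toSpacetime.deviationCk (Minkowski.backgroundOn U₀) Ψ₀ 2 τ) atTop (𝓝 0)

-- earlier LorentzianAlmostRigidity (stmt-FinalStateConjecture-14575, replaced 2026-08-16T03:46:02Z -> stmt-FinalStateConjecture-14547): retired by None — ∀ (v₀ ρ₀ η : ℝ), 0 < v₀ → 0 < ρ₀ → 0 < η → ∃ ε : ℝ, 0 < ε ∧ ∀ (𝓢 : Literature.Geometry.Lorentzian.Spacetime.{0} 4) [𝓢.metric.HasLeviCivita], 𝓢.metric.toPseudoRiemannianMetric.IsRicciFlat → 𝓢.metric.IsGloballyHyperbolic 𝓢.timeOrientation → ∀ (p : 𝓢.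
-- earlier LorentzianAlmostRigidity (stmt-FinalStateConjecture-9993, replaced 2026-08-16T03:32:50Z -> stmt-FinalStateConjecture-14575): retired by None — [crux] LORENTZIAN ALMOST-RIGIDITY FOR VACUUM, scale-invariant (card raychaudhuri-bishop-gromov-blowdown, K1; the tool BlowdownFlatChart runs on). There is δ(ε) → 0 as ε → 0 such that for every globally hyperbolic vacuum (Ric = 0) 3+1 spacetime, ever
/-- item stmt-FinalStateConjecture-14547 · crux · rank 5 · open · by planner
why it might fail: No Lorentzian Cheeger–Colding (no C⁰ precompactness in Lorentzian signature; TCD almost-splitting false, arXiv:2605.03172); density defect is 2nd order in shear, distortion 1st (ε buys √ε); 3D step 'almost-umbilic vacuum slices ⇒ q C⁰-near φ*h off small measure' lacks pointwise curvature control.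
sources: CheegerColding1996, Colding1997, TreudeGrant2012, EhrlichSanchez2000, EhrlichJungKim1998, CavallettiMondino2020
[crux] LORENTZIAN ALMOST-RIGIDITY FOR VACUUM PENCILS — REPAIRED FORM C′ (2026-08-16; replaces the
over-U / identity-identification form refuted on paper by the Kasner comoving pencil, the near-flat
Kasner pencil and the Kruskal radial escape pencil, item evidence EVIDENCE.md of stmt-9993).
Non-collapsed, measured, SOME-cone, C⁰ only: for all v₀ > 0 (non-collapsing floor), ρ₀ > 0 (pencil
radius) and η > 0 there is ε > 0 such that for every globally hyperbolic vacuum (Ric = 0) 3+1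
spacetime 𝓢, every event p, every future unit timelike u at p and every scale τ > 0, writing U :=
the hyperbolic ball B_{ρ₀}(u) ⊂ H⁺_p (shape normalisation) and Θ = Spacetime.futureConeDensity
(Minkowski value 1): IF (a) the timelike cut function exceeds 4τ on the CLOSED ball (every
unit-speed geodesic γ_v, ∠(u,v) ≤ ρ₀, maximises the time separation from p beyond 4τ), (b) Θ_p(U;4τ)
≥ v₀ and (c) the density drops little, Θ_p(U;τ) ≤ Θ_p(U;4τ) + ε, THEN there are a bad set U_bad ⊆ U
of hyperbolic measure ≤ η·|U|, an open V ⊇ U∖U_bad in T_pM and a C¹ map φ : T_pM → T_pM on V sending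
V ∩ H⁺_p into H⁺_p with dφ_v injective on v^⊥ for v ∈ U∖U_bad (an immersion of directions — the
're-identification' the Kruskal wi -/
@[route_item "route-FinalStateConjecture-RaychaudhuriBlowdown"]
def LorentzianAlmostRigidity : Prop :=
  ∀ (v₀ ρ₀ η : ℝ), 0 < v₀ → 0 < ρ₀ → 0 < η → ∃ ε : ℝ, 0 < ε ∧ ∀ (𝓢 : Literature.Geometry.Lorentzian.Spacetime.{0} 4) [𝓢.metric.HasLeviCivita], 𝓢.metric.toPseudoRiemannianMetric.IsRicciFlat → 𝓢.metric.IsGloballyHyperbolic 𝓢.timeOrientation → ∀ (p : 𝓢.carrier) (u : TangentSpace (𝓡 4) p), u ∈ 𝓢.timeOrientation.futureUnitTimelike p → ∀ (τ : ℝ), 0 < τ → (∀ v ∈ 𝓢.timeOrientation.futureUnitTimelike p, 𝓢.metric.hyperbolicAngle u v ≤ ρ₀ → ENNReal.ofReal (4 * τ) < 𝓢.timeOrientation.timelikeCut p v) → ENNReal.ofReal v₀ ≤ 𝓢.futureConeDensity p (𝓢.timeOrientation.hyperboloidBall u ρ₀) (4 * τ) → 𝓢.futureConeDensity p (𝓢.timeOrientation.hyperboloidBall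 u ρ₀) τ ≤ 𝓢.futureConeDensity p (𝓢.timeOrientation.hyperboloidBall u ρ₀) (4 * τ) + ENNReal.ofReal ε → ∃ (Ubad : Set (TangentSpace (𝓡 4) p)) (V : Set (EuclideanSpace ℝ (Fin 4))) (φ : EuclideanSpace ℝ (Fin 4) → EuclideanSpace ℝ (Fin 4)), Ubad ⊆ 𝓢.timeOrientation.hyperboloidBall u ρ₀ ∧ 𝓢.metric.hyperbolicMeasure p Ubad ≤ ENNReal.ofReal η * 𝓢.metric.hyperbolicMeasure p (𝓢.timeOrientation.hyperboloidBall u ρ₀) ∧ IsOpen V ∧ (𝓢.timeOrientation.hyperboloidBall u ρ₀ \ Ubad : Set (EuclideanSpace ℝ (Fin 4))) ⊆ V ∧ ContDiffOn ℝ 1 φ V ∧ (∀ w ∈ V, (show TangentSpace (𝓡 4) p from w) ∈ 𝓢.timeOrientation.futureUnitTimelike p → (show TangentSpace (𝓡 4) p from φ w) ∈ 𝓢.timeOrientation.futureUnitTimelike p) ∧ (∀ v ∈ 𝓢.timeOrientation.hyperboloidBall u ρ₀ \ Ubad, ∀ X : EuclideanSpace ℝ (Fin 4), 𝓢.metric.val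 p v X = 0 → fderiv ℝ φ v X = 0 → X = 0) ∧ ∀ v ∈ 𝓢.timeOrientation.hyperboloidBall u ρ₀ \ Ubad, ∀ t ∈ Set.Icc τ (2 * τ), ∀ X : EuclideanSpace ℝ (Fin 4), |𝓢.metric.val (Literature.Geometry.Riemannian.expMap 𝓢.metric.leviCivita p (t • v)) (mfderiv 𝓘(ℝ, EuclideanSpace ℝ (Fin 4)) (𝓡 4) (fun w : EuclideanSpace ℝ (Fin 4) ↦ Literature.Geometry.Riemannian.expMap 𝓢.metric.leviCivita p (show TangentSpace (𝓡 4) p from w)) (show EuclideanSpace ℝ (Fin 4) from t • v) X) (mfderiv 𝓘(ℝ, EuclideanSpace ℝ (Fin 4)) (𝓡 4) (fun w : EuclideanSpace ℝ (Fin 4) ↦ Literature.Geometry.Riemannian.expMap 𝓢.metric.leviCivita p (show TangentSpace (𝓡 4) p from w)) (show EuclideanSpace ℝ (Fin 4) from t • v) X) - 𝓢.metric.val p (fderiv ℝ (fun w : EuclideanSpace ℝ (Fin 4) ↦ Real.sqrt (-(𝓢.metric.val p w w)) • φ ((Real.sqrt (-(𝓢.metric.val p w w)))⁻¹ • w)) (t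 • v) X) (fderiv ℝ (fun w : EuclideanSpace ℝ (Fin 4) ↦ Real.sqrt (-(𝓢.metric.val p w w)) • φ ((Real.sqrt (-(𝓢.metric.val p w w)))⁻¹ • w)) (t • v) X)| ≤ η * (𝓢.metric.val p (fderiv ℝ (fun w : EuclideanSpace ℝ (Fin 4) ↦ Real.sqrt (-(𝓢.metric.val p w w)) • φ ((Real.sqrt (-(𝓢.metric.val p w w)))⁻¹ • w)) (t • v) X) (fderiv ℝ (fun w : EuclideanSpace ℝ (Fin 4) ↦ Real.sqrt (-(𝓢.metric.val p w w)) • φ ((Real.sqrt (-(𝓢.metric.val p w w)))⁻¹ • w)) (t • v) X) + 2 * (𝓢.metric.val p (φ v) (fderiv ℝ (fun w : EuclideanSpace ℝ (Fin 4) ↦ Real.sqrt (-(𝓢.metric.val p w w)) • φ ((Real.sqrt (-(𝓢.metric.val p w w)))⁻¹ • w)) (t • v) X)) ^ 2)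

/-- item stmt-FinalStateConjecture-17673 · crux · rank 6 · open · by planner
why it might fail: ∀-datum INTERIOR claim: every null ray from Σ entering the black-hole region must be incomplete in the MGHD — known only for exact Kerr and near i⁺ (Dafermos–Luk); a complete infalling ray in a non-generic interior with smooth Cauchy horizon, or a legal fd whose O undercuts the d.o.c., breaks it.
sources: arXiv:1710.01722, DafermosLuk2017, Penrose1965, ONeill1983, HawkingEllis1973, arXiv:0811.0354
[crux] [Statement re-type p126844 (C): the intrinsic lower bound on the settled region — the audit's
'interior statement in disguise' (docs/m5/audits/retype-2026-08-16/fsc/REPORT.md §5 Q1), isolated as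
its own ∀-datum item] For EVERY admissible datum D, every MGHD 𝒟 with complete 𝓘⁺ in the sojourn
sense (`Summit.FinalStateConjecture.HasCompleteNullInfinity`) and EVERY N-hole
`FinalStateDecomposition fd` of O ⊆ M in C² with sub-extremal holes, O = J⁺(ιΣ) ∩ I⁻(fd.charted)
(`exteriorOf`), `HasExhaustiveCharts fd` and `IsFutureOriented fd`:
`Summit.FinalStateConjecture.RaysStayInClosure 𝒟 O` — every future-complete normalised null ray γ
from a data point (maximal null geodesic, γ 0 = ι p, normalised against the unit normal, affine
domain unbounded above) satisfies γ t ∈ closure O for all parameters t ≥ 0. Content: a ray that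
leaves closure(I⁻(charted)) has entered the black-hole region B = J⁺(ιΣ) ∖ closure O, a future set
it can never leave (push-up), so (i) every null ray from Σ entering B must be affinely INCOMPLETE in
the MGHD (exact sub-extremal Kerr: r decreases from r₊ to r₋, reached at finite affine parameter;
perturbatively near i⁺: the Dafermos–Luk C⁰-stable Cauchy horizon lie -/
@[route_item "route-FinalStateConjecture-RaychaudhuriBlowdown", crux]
def SettledExteriorHoldsRays : Prop :=
  open Literature.Geometry.Lorentzian in open scoped ContDiff in ∀ (X : Type) [TopologicalSpace X] [ChartedSpace E3 X] [IsManifold (𝓡 3) ∞ X] [T2Space X] [SecondCountableTopology X] [ConnectedSpace X] (D : InitialDataSet (𝓡 3) X), D ∈ admissibleVacuumData X → ∀ 𝒟 : VacuumCauchyDevelopment D, 𝒟.IsMaximal → Summit.FinalStateConjecture.HasCompleteNullInfinity 𝒟.toCauchyDevelopment → ∀ (O : Set 𝒟.carrier) (fd : FinalStateDecomposition 𝒟.toSpacetime O 2), (∀ i, Kerr.IsSubextremal (fd.mass i) (fd.spin i)) → O = Summit.FinalStateConjecture.exteriorOf 𝒟.toCauchyDevelopment fd.charted → Summit.FinalStateConjecture.HasExhaustiveCharts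 fd → Summit.FinalStateConjecture.IsFutureOriented fd → Summit.FinalStateConjecture.RaysStayInClosure 𝒟.toCauchyDevelopment O

/-- item stmt-FinalStateConjecture-9958 · support · rank 9 · open · by planner
sources: TreudeGrant2012, HawkingEllis1973
[support] Riccati comparison behind Raychaudhuri/Bishop–Gromov (card P1, analytic core): any θ
differentiable on (0,T) with θ' ≤ −θ²/3 satisfies θ(t) ≤ 3/t there (no initial condition needed: a
larger value would blow up backwards before t = 0). [difficulty: provable-now] -/
@[route_item "route-FinalStateConjecture-RaychaudhuriBlowdown"]
def RaychaudhuriRiccatiBound : Prop :=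
  ∀ (T : ℝ) (θ : ℝ → ℝ), (∀ t ∈ Set.Ioo 0 T, DifferentiableAt ℝ θ t ∧ deriv θ t ≤ -(θ t) ^ 2 / 3) → ∀ t ∈ Set.Ioo 0 T, θ t ≤ 3 / t

/-- item stmt-FinalStateConjecture-9959 · support · rank 9 · open · by planner
sources: TreudeGrant2012, EhrlichJungKim1998, CheegerColding1996
[support] Bishop–Gromov integration step (card P1): if A > 0 is continuous on [0,T), differentiable
on (0,T) with A' ≤ (3/t)A (area of distance spheres of a vacuum timelike cone sector), then τ ↦
(∫₀^τ A)/τ⁴ is antitone on (0,T) (Gromov's ratio lemma; the cone density Θ_p(U;·) is this ratio up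
to the constant |U|/4). [difficulty: provable-now] -/
@[route_item "route-FinalStateConjecture-RaychaudhuriBlowdown"]
def BishopGromovRatioAntitone : Prop :=
  ∀ (T : ℝ) (A : ℝ → ℝ), ContinuousOn A (Set.Ico 0 T) → (∀ t ∈ Set.Ioo 0 T, 0 < A t ∧ DifferentiableAt ℝ A t ∧ deriv A t ≤ 3 / t * A t) → AntitoneOn (fun τ ↦ (∫ t in (0:ℝ)..τ, A t) / τ ^ 4) (Set.Ioo 0 T)

/-- item stmt-FinalStateConjecture-9960 · support · rank 9 · open · by planner
sources: TreudeGrant2012, HawkingEllis1973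
[support] Per-ray bulk dissipation budget (card P2): along a ray where θ' = −θ²/3 − s with s ≥ 0
continuous (s = |σ|² in vacuum) on [τ₀,T] and θ(T) ≥ 0 (no refocusing yet), ∫_{τ₀}^T s ≤ θ(τ₀) (≤
3/τ₀ by RaychaudhuriRiccatiBound). [difficulty: provable-now] -/
@[route_item "route-FinalStateConjecture-RaychaudhuriBlowdown"]
def ShearBudget : Prop :=
  ∀ (τ₀ T : ℝ) (θ s : ℝ → ℝ), τ₀ ≤ T → ContinuousOn s (Set.Icc τ₀ T) → (∀ t ∈ Set.Icc τ₀ T, HasDerivAt θ (-(θ t) ^ 2 / 3 - s t) t) → (∀ t ∈ Set.Icc τ₀ T, 0 ≤ s t) → 0 ≤ θ T → ∫ t in τ₀..T, s t ≤ θ τ₀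

-- earlier Assembly (stmt-FinalStateConjecture-9961, replaced 2026-08-16T23:48:27Z -> stmt-FinalStateConjecture-18028): retired by None — GenericCensorshipFlatCone → NearZoneCompletion → _root_.FinalStateConjecture
/-- item stmt-FinalStateConjecture-18028 · assembly · rank 1 · open · by planner
sources: DafermosLuk2017, Christodoulou1999
[assembly] GenericCensorshipFlatCone → NearZoneCompletion → SettledExteriorHoldsRays →
FinalStateConjecture (re-typed Statement p126844). Literally the type of the deciding theorem closes
(glue.lean: lean check rc 0, 0 sorries, axioms propext / Classical.choice / Quot.sound): tame
Christodoulou-genericity is monotone in the property; NearZoneCompletion gives O, d with exhaustive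
future-oriented charts, GenericCensorshipFlatCone (iii) sub-extremality, SettledExteriorHoldsRays
the ray clause. RESTATED 2026-08-16 (the pre-retype Assembly C1 → C2 → Statement is superseded). -/
@[route_item "route-FinalStateConjecture-RaychaudhuriBlowdown"]
def Assembly : Prop :=
  GenericCensorshipFlatCone → NearZoneCompletion → SettledExteriorHoldsRays → _root_.FinalStateConjecture

/-! D-0027 §2.1 — DECIDING THEOREM (planner-authored via `route open/edit --closes-file`; by planner-rbadge-FinalStateConjecture-Raychaudhu-cebb32eb-g3-0 2026-08-17T00:31:45Z):
its hypotheses are this route's items and its conclusion the sub-problem Statement (glue_lint), and it elaborates with this file. -/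

@[closes "route-FinalStateConjecture-RaychaudhuriBlowdown"] theorem closes (h₁ : GenericCensorshipFlatCone) (h₂ : NearZoneCompletion) (h₃ : SettledExteriorHoldsRays) : _root_.FinalStateConjecture := by
  intro X _ _ _ _ _ _
  -- TAME Christodoulou-genericity (tame codimension 1, one fixed end) is monotone in the property
  -- along implications valid on the admissible class: the same end and the same tame, immersed,
  -- injective admissible family through a Q-exceptional datum serve for P.
  have mono : ∀ (P Q : Literature.Geometry.Lorentzian.InitialDataSet (𝓡 3) X → Prop),
      (∀ D ∈ Literature.Geometry.Lorentzian.admissibleVacuumData X, P D → Q D) →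
      Literature.Geometry.Lorentzian.InitialDataSet.IsTameChristodoulouGeneric
        (Literature.Geometry.Lorentzian.admissibleVacuumData X) P 1 →
      Literature.Geometry.Lorentzian.InitialDataSet.IsTameChristodoulouGeneric
        (Literature.Geometry.Lorentzian.admissibleVacuumData X) Q 1 := by
    intro P Q hPQ hP d hd
    obtain ⟨e, F, hF, hI, h0, hinj, hmem, hE⟩ := hP d ⟨hd.1, fun h ↦ hd.2 (hPQ d hd.1 h)⟩
    exact ⟨e, F, hF, hI, h0, hinj, hmem, fun c hc hc' ↦ hE c hc ⟨hc'.1, fun h ↦ hc'.2 (hPQ _ hc'.1 h)⟩⟩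
  refine mono _ _ ?_ (h₁ X)
  -- pointwise on admissible data: (i) complete 𝓘⁺ and (ii) the flat cone feed NearZoneCompletion,
  -- which returns O, d with O = exteriorOf d.charted, exhaustive and future-oriented charts;
  -- (iii) applied to that very d gives sub-extremality; SettledExteriorHoldsRays gives the ray clause.
  rintro D hD ⟨hex, hall⟩
  refine ⟨hex, fun 𝒟 h𝒟 ↦ ?_⟩
  obtain ⟨hcni, hfar, hsub⟩ := hall 𝒟 h𝒟
  obtain ⟨O, dd, hO, hexh, hfo⟩ := h₂ X D hD 𝒟 h𝒟 hcni hfar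
  have hse : ∀ i, Literature.Geometry.Lorentzian.Kerr.IsSubextremal (dd.mass i) (dd.spin i) :=
    hsub O dd hO hexh hfo
  exact ⟨hcni, O, dd, hse, hO, h₃ X D hD 𝒟 h𝒟 hcni O dd hse hO hexh hfo, hexh, hfo⟩

end Summit.FinalStateConjecture.FinalStateConjecture.Theses.RaychaudhuriBlowdown
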